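import Literature.NumberTheory.LFunctions.DivisorLogMomentWindow
import Literature.NumberTheory.LFunctions.DivisorSumCharSqResidueData
import Literature.NumberTheory.LFunctions.DivisorSumCharSqRemainderDeepLine
import Literature.NumberTheory.LFunctions.ConreyIwaniec2002Prop91LargeOfLargeRange
import Literature.NumberTheory.LFunctions.ConreyIwaniec2002CorTenTwoWeak
import Literature.NumberTheory.LFunctions.ConreyIwaniec2002ThmOneOneWeak
import HarnessLib

/-!
# Conrey–Iwaniec (2002), Corollary 6.3 in the large range `X ≥ q²` — PROVED; the CI side of the Landau–Siegel door modulo Proposition 8.1 alone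

Conrey–Iwaniec, *Spacing of zeros of Hecke L-functions and the class number problem*, Acta Arith.
103 (2002), §6 p. 16 [held text `paper:arxiv-math_0111012` p0016:L97–160]:

> **Corollary 6.3.** For `Y ≥ 2X ≥ 2` we have
> `Σ_{X ≤ n ≤ Y} τ²(n,χ) n^{-1} ≪ ℒ(Y) log(Y/X) + (q/X)^{1/2}` (6.49), where
> `ℒ(Y) = L(1,χ)(L(1,χ) log Y + |L′(1,χ)|)` (6.50).

The typed named fact `conreyIwaniec2002_corollary63` (`ConreyIwaniec2002SpacingMechanism.lean`) is
this statement with ONE absolute constant for all `X ≥ 1`; its remainder encodes the printed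
"`R_K(s) ≪ q^{1/2}|s|^{5/6}` on `Re s = ½`" (Weyl and hybrid subconvexity; no proof in the source,
none in the tree) and stays a named fact. PROVED HERE: the LARGE-RANGE SIBLING

  `ConreyIwaniec2002.corollary63_large : ∃ C > 0, ∀ q > 4, ∀ χ primitive quadratic odd mod q,
     ∀ X Y, q² ≤ X → 2X ≤ Y → Σ_{⌈X⌉ ≤ n ≤ ⌊Y⌋} |τ(n,χ)|²/n ≤ C (ℒ(Y) log(Y/X) + √q · X^{-9/20})`

(binders verbatim those of the typed decl, `1 ≤ X` replaced by `q² ≤ X`), which covers EVERY use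
of (6.49) in §§6–9 (Proposition 9.1: `X = q²+1`, `Y = q⁴`; §8: `q⁴ ≪ n ≪ T`, `x, y ≍ q⁴`;
Proposition 6.4: `X = T ≥ q^65`). Proof = the printed Mellin argument (6.46)–(6.48) organised
through the tree's explicit formula for the smoothed logarithmic second moment of `ν = 1 ∗ χ`
(`DivisorSumCharSq.explicit_formula`) and the smoothing majorant `Zhang2022.Lemma31.sum_Ioc_le`,
with the three inputs landed for this line (SKELETON I6c 47970a6266d02b83, cell
landau-siegel/ls-inputs, line `smoothed-mellin-large`): the divisor log-window
(`DivisorSumCharSq.norm_W_dCoeff_window_le`), the residue data `g(0)`, `g′(0)`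
(`DivisorSumCharSq.gFun_zero_bounds`) and the remainder on the line `re z = −9/20`
(`DivisorSumCharSq.explicit_formula_remainder_le`). In the large range `log q ≤ ½ log Y`, which puts
the `L(1,χ)² log q` part of `g′(0)` (Conrey–Iwaniec's `β`, (6.45)) inside `ℒ(Y)`.

CONSEQUENCES (the tree edge `prop91_large_of_prop81_large_corollary63_large` of
`ConreyIwaniec2002Prop91LargeOfLargeRange.lean`, then `principalEstimate_of`,
`proposition101_weak_of_principalEstimate_weak`, `corollary102_of_proposition101_weak`,
`theorem11_weak_of_proposition101_weak`): Proposition 9.1 (`_large`), Proposition 9.2 (as typed,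
given the printed (9.11) claim; fact-free with exponent `7/2`), Corollary 10.2 (= Theorem 1.2 for
odd `q`, `−90`) and Theorem 1.1-weak (odd `q`, `−(2A+7)`) **from Proposition 8.1 ALONE** (the
`_large` binder `q^65 ≤ T ∧ e^{(log q)²} ≤ T` suffices; the typed `conreyIwaniec2002_proposition81`
implies it). The Conrey–Iwaniec side of the cell's Landau–Siegel door now rests on ONE typed fact.

«The programme SEARCHES and TYPES; no claim about Landau–Siegel zeros, Theorems 1–2 of
arXiv:2211.02515 or a repaired Margin232 until a kernel theorem says so.»

## References
* [ConreyIwaniec2002] B. Conrey, H. Iwaniec, Acta Arith. 103 (2002) 259–312: §6 (6.42)–(6.50),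
  Corollary 6.3; §8 p. 18, Proposition 8.1; §9 p. 20, Propositions 9.1–9.2; §10 Corollary 10.2,
  Theorem 1.1.
* [Zhang2022LandauSiegel] Y. Zhang, arXiv:2211.02515, §3 (the Mellin skeleton only).
-/

noncomputable section

open scoped NumberField
open Complex

namespace Literature.NumberTheory.LFunctions

namespace ConreyIwaniec2002

open NumberField
open Literature.NumberTheory.LFunctions.DivisorSumCharSq (W gFun norm_W_dCoeff_window_le
  gFun_zero_bounds explicit_formula_remainder_le)
open Literature.NumberTheory.LFunctions.ZetaM4 (dCoeff)
open Literature.NumberTheory.LFunctions.Zhang2022.Lemma31 (sum_Ioc_le)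

/-! ### The assembly: Corollary 6.3 in the large range from the three landed inputs -/

/-- **COROLLARY 6.3 FOR `X ≥ q²` FROM THE THREE INPUTS** (divisor log-window `h1`, residue data `h2`,
remainder on `re z = −9/20` `h3`; the smoothing majorant and the explicit formula are tree theorems): `Σ_{⌈X⌉ ≤ n ≤ ⌊Y⌋} τ(n,χ)²/n ≤ C(ℒ(Y) log(Y/X) + √q X^{-9/20})`,
`C = 36 C₁C₂ + 18 C₂ + 12 C₃`. [cite: ConreyIwaniec2002, Corollary 6.3 (6.49)] -/
theorem corollary63_large_of
    (h1 : ∃ C : ℝ, 0 < C ∧ ∀ A B : ℝ, 1 ≤ A → 4 * A ≤ B →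
      ‖W dCoeff B - W dCoeff A‖ ≤ C * (1 + Real.log B) * Real.log (B / A))
    (h2 : ∃ C : ℝ, 0 < C ∧ ∀ (q : ℕ) [NeZero q], 4 < q → ∀ χ : DirichletCharacter ℂ q,
      χ.IsPrimitive →
      ‖gFun χ 0‖ ≤ C * ‖χ.LFunction 1‖ ^ 2 ∧
      ‖deriv (gFun χ) 0‖ ≤
        C * (‖χ.LFunction 1‖ * ‖deriv χ.LFunction 1‖ + ‖χ.LFunction 1‖ ^ 2 * (Real.log q + 1)))
    (h3 : ∃ C : ℝ, 0 < C ∧ ∀ (q : ℕ) [NeZero q], 4 < q → ∀ χ : DirichletCharacter ℂ q,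
      χ.IsPrimitive → χ ^ 2 = 1 → ∀ A B : ℝ, 1 ≤ A → A ≤ B →
        ‖(W (fun n => divisorSumChar χ n ^ 2) B - W (fun n => divisorSumChar χ n ^ 2) A) -
            gFun χ 0 * (W dCoeff B - W dCoeff A) -
            (Real.log B - Real.log A) * deriv (gFun χ) 0‖ ≤
          C * Real.sqrt q * A ^ (-(9 / 20 : ℝ))) :
    ∃ C : ℝ, 0 < C ∧
      ∀ (q : ℕ) [NeZero q], 4 < q → ∀ χ : DirichletCharacter ℂ q,
        χ.IsPrimitive → χ.IsQuadratic → χ.Odd →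
          ∀ X Y : ℝ, (q : ℝ) ^ 2 ≤ X → 2 * X ≤ Y →
            ∑ n ∈ Finset.Icc ⌈X⌉₊ ⌊Y⌋₊, ‖divisorSumChar χ n‖ ^ 2 / (n : ℝ) ≤
              C * (calL χ Y * Real.log (Y / X) + Real.sqrt q * X ^ (-(9 / 20 : ℝ))) := by
  obtain ⟨C₁, hC₁, h1⟩ := h1
  obtain ⟨C₂, hC₂, h2⟩ := h2
  obtain ⟨C₃, hC₃, h3⟩ := h3
  refine ⟨36 * C₁ * C₂ + 18 * C₂ + 12 * C₃, by positivity,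
    fun q _ hq χ hprim hquad _ X Y hX hXY => ?_⟩
  -- numerics of the range
  have hq5 : (5 : ℝ) ≤ q := by exact_mod_cast hq
  have hq25 : (25 : ℝ) ≤ (q : ℝ) ^ 2 := by nlinarith
  have hX25 : 25 ≤ X := hq25.trans hX
  have hX0 : 0 < X := by linarith
  have hY0 : 0 < Y := by linarith
  have hYX : 2 ≤ Y / X := by rw [le_div_iff₀ hX0]; linarith
  have hlogYX : Real.log 2 ≤ Real.log (Y / X) := Real.log_le_log (by norm_num) hYX
  have hlog2 : (1 : ℝ) / 2 < Real.log 2 := by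
    have := Real.log_two_gt_d9; linarith
  have hlogYX0 : 0 < Real.log (Y / X) := by linarith
  have hY50 : (50 : ℝ) ≤ Y := by linarith
  have hlogY : 3 ≤ Real.log Y := by
    rw [Real.le_log_iff_exp_le hY0]
    have h3 : Real.exp 3 < 50 := by
      have h1 := Real.exp_one_lt_d9
      have : Real.exp 3 = Real.exp 1 * Real.exp 1 * Real.exp 1 := by
        rw [← Real.exp_add, ← Real.exp_add]; norm_num
      rw [this]; nlinarith [Real.exp_pos 1]
    linarith
  have hlogq : Real.log q ≤ Real.log Y / 2 := by
    have h1 : Real.log ((q : ℝ) ^ 2) ≤ Real.log Y :=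
      Real.log_le_log (by positivity) (hX.trans (by linarith))
    rw [Real.log_pow] at h1; push_cast at h1; linarith
  have hlogq0 : 0 ≤ Real.log q := Real.log_nonneg (by linarith)
  -- the window `(A, B] = (X/4, Y]`
  set A : ℝ := X / 4 with hA
  have hA1 : 1 ≤ A := by rw [hA]; linarith
  have hA0 : 0 < A := by linarith
  have hAB : 4 * A ≤ Y := by rw [hA]; linarith
  have hAB' : A ≤ Y := by linarith
  have hBA : Y / A = 4 * (Y / X) := by rw [hA]; field_simp
  have hlogBA : Real.log Y - Real.log A = Real.log (Y / A) := (Real.log_div hY0.ne' hA0.ne').symm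
  have hlog4 : Real.log 4 ≤ 2 * Real.log (Y / X) := by
    rw [show (4 : ℝ) = 2 ^ 2 by norm_num, Real.log_pow]; push_cast; linarith
  have hlogBA3 : Real.log (Y / A) ≤ 3 * Real.log (Y / X) := by
    rw [hBA, Real.log_mul (by norm_num) (by positivity)]; linarith
  have hlogBA0 : 0 ≤ Real.log (Y / A) := by
    rw [hBA]; exact Real.log_nonneg (by linarith)
  -- the integer window
  set M : ℕ := ⌈X⌉₊ - 1 with hM
  set N : ℕ := ⌊Y⌋₊ with hN
  have hceil1 : 1 ≤ ⌈X⌉₊ := Nat.one_le_iff_ne_zero.mpr (by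
    intro h; rw [Nat.ceil_eq_zero] at h; linarith)
  have hIcc : Finset.Icc ⌈X⌉₊ ⌊Y⌋₊ = Finset.Ioc M N := by
    rw [hM, hN, ← Finset.Icc_add_one_left_eq_Ioc, Nat.sub_add_cancel hceil1]
  have hAM : A ≤ (M : ℝ) := by
    have h1 : (X : ℝ) ≤ (⌈X⌉₊ : ℝ) := Nat.le_ceil X
    have h2 : ((M : ℕ) : ℝ) = (⌈X⌉₊ : ℝ) - 1 := by
      rw [hM]; push_cast [Nat.cast_sub hceil1]; ring
    rw [h2, hA]; linarith
  have hNB : (N : ℝ) ≤ Y := by rw [hN]; exact Nat.floor_le hY0.le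
  -- smoothing
  have hχ2 : χ ^ 2 = 1 := hquad.sq_eq_one
  have hsm := sum_Ioc_le χ hχ2 hA0 hAB hAM hNB
  rw [hIcc]
  refine hsm.trans ?_
  -- the explicit formula, through S2–S3
  set L1 : ℝ := ‖χ.LFunction 1‖ with hL1
  set L1' : ℝ := ‖deriv χ.LFunction 1‖ with hL1'
  have hL10 : 0 ≤ L1 := norm_nonneg _
  have hL1'0 : 0 ≤ L1' := norm_nonneg _
  obtain ⟨hg0, hg1⟩ := h2 q hq χ hprim
  have hrem := h3 q hq χ hprim hχ2 A Y hA1 hAB'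
  have hWd := h1 A Y hA1 hAB
  set Δ : ℂ := W (fun n => divisorSumChar χ n ^ 2) Y - W (fun n => divisorSumChar χ n ^ 2) A
    with hΔ
  set E : ℂ := Δ - gFun χ 0 * (W dCoeff Y - W dCoeff A) -
      (Real.log Y - Real.log A) * deriv (gFun χ) 0 with hE
  have hΔeq : Δ = gFun χ 0 * (W dCoeff Y - W dCoeff A) +
      (Real.log Y - Real.log A) * deriv (gFun χ) 0 + E := by rw [hE]; ring
  have hΔre : Δ.re ≤ ‖gFun χ 0‖ * ‖W dCoeff Y - W dCoeff A‖ +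
      Real.log (Y / A) * ‖deriv (gFun χ) 0‖ + ‖E‖ := by
    calc Δ.re ≤ ‖Δ‖ := Complex.re_le_norm _
      _ ≤ ‖gFun χ 0 * (W dCoeff Y - W dCoeff A) +
            ((Real.log Y - Real.log A : ℝ) : ℂ) * deriv (gFun χ) 0‖ + ‖E‖ := by
          rw [hΔeq]; push_cast; exact norm_add_le _ _
      _ ≤ ‖gFun χ 0 * (W dCoeff Y - W dCoeff A)‖ +
            ‖((Real.log Y - Real.log A : ℝ) : ℂ) * deriv (gFun χ) 0‖ + ‖E‖ := by
          gcongr; exact norm_add_le _ _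
      _ = _ := by
          rw [norm_mul, norm_mul, Complex.norm_real, hlogBA, Real.norm_eq_abs,
            abs_of_nonneg hlogBA0]
  -- real-variable assembly
  have hrpow : A ^ (-(9 / 20 : ℝ)) ≤ 2 * X ^ (-(9 / 20 : ℝ)) := by
    have hA' : A = X * (1 / 4) := by rw [hA]; ring
    rw [hA', Real.mul_rpow hX0.le (by norm_num)]
    have h14 : ((1 : ℝ) / 4) ^ (-(9 / 20 : ℝ)) ≤ 2 := by
      rw [Real.rpow_neg (by norm_num), show ((1:ℝ)/4) = 4⁻¹ by norm_num, Real.inv_rpow (by norm_num),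
        inv_inv]
      calc (4 : ℝ) ^ ((9 : ℝ) / 20) ≤ (4 : ℝ) ^ ((1 : ℝ) / 2) :=
            Real.rpow_le_rpow_of_exponent_le (by norm_num) (by norm_num)
        _ = 2 := by
            rw [show (4 : ℝ) = 2 ^ (2 : ℝ) by norm_num, ← Real.rpow_mul (by norm_num)]; norm_num
    have hXr : 0 ≤ X ^ (-(9 / 20 : ℝ)) := Real.rpow_nonneg hX0.le _
    calc X ^ (-(9 / 20 : ℝ)) * (1 / 4 : ℝ) ^ (-(9 / 20 : ℝ)) ≤ X ^ (-(9 / 20 : ℝ)) * 2 := by gcongr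
      _ = 2 * X ^ (-(9 / 20 : ℝ)) := by ring
  have hsq0 : 0 ≤ Real.sqrt q := Real.sqrt_nonneg _
  have hXr0 : 0 ≤ X ^ (-(9 / 20 : ℝ)) := Real.rpow_nonneg hX0.le _
  have hE' : ‖E‖ ≤ 2 * C₃ * Real.sqrt q * X ^ (-(9 / 20 : ℝ)) := by
    calc ‖E‖ ≤ C₃ * Real.sqrt q * A ^ (-(9 / 20 : ℝ)) := hrem
      _ ≤ C₃ * Real.sqrt q * (2 * X ^ (-(9 / 20 : ℝ))) := by gcongr
      _ = _ := by ring
  have hlogB1 : 1 + Real.log Y ≤ 2 * Real.log Y := by linarith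
  have hlq4 : Real.log q + 1 ≤ Real.log Y := by linarith
  have hcalL : calL χ Y = L1 * (L1 * Real.log Y + L1') := rfl
  -- term 1: `‖g(0)‖ ‖W_d(B) − W_d(A)‖ ≤ C₂ L1² · C₁ · 2 log Y · 3 log(Y/X)`
  have hT1 : ‖gFun χ 0‖ * ‖W dCoeff Y - W dCoeff A‖ ≤
      6 * C₁ * C₂ * (L1 ^ 2 * Real.log Y) * Real.log (Y / X) := by
    calc ‖gFun χ 0‖ * ‖W dCoeff Y - W dCoeff A‖
        ≤ (C₂ * L1 ^ 2) * (C₁ * (1 + Real.log Y) * Real.log (Y / A)) :=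
          mul_le_mul hg0 hWd (norm_nonneg _) (by positivity)
      _ ≤ (C₂ * L1 ^ 2) * (C₁ * (2 * Real.log Y) * (3 * Real.log (Y / X))) := by gcongr
      _ = _ := by ring
  -- term 2: `log(B/A) ‖g′(0)‖ ≤ 3 log(Y/X) C₂ (L1 L1' + L1² log Y)`
  have hT2 : Real.log (Y / A) * ‖deriv (gFun χ) 0‖ ≤
      3 * C₂ * Real.log (Y / X) * (L1 * L1' + L1 ^ 2 * Real.log Y) := by
    calc Real.log (Y / A) * ‖deriv (gFun χ) 0‖
        ≤ (3 * Real.log (Y / X)) * (C₂ * (L1 * L1' + L1 ^ 2 * (Real.log q + 1))) :=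
          mul_le_mul hlogBA3 hg1 (norm_nonneg _) (by positivity)
      _ ≤ (3 * Real.log (Y / X)) * (C₂ * (L1 * L1' + L1 ^ 2 * Real.log Y)) := by gcongr
      _ = _ := by ring
  have hmain : Δ.re ≤ (6 * C₁ * C₂ + 3 * C₂) * (calL χ Y * Real.log (Y / X)) +
      2 * C₃ * Real.sqrt q * X ^ (-(9 / 20 : ℝ)) := by
    have hP : 0 ≤ L1 * L1' * Real.log (Y / X) := by positivity
    have := add_le_add (add_le_add hT1 hT2) hE'
    have h' : 6 * C₁ * C₂ * (L1 ^ 2 * Real.log Y) * Real.log (Y / X) +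
        3 * C₂ * Real.log (Y / X) * (L1 * L1' + L1 ^ 2 * Real.log Y) ≤
        (6 * C₁ * C₂ + 3 * C₂) * (calL χ Y * Real.log (Y / X)) := by
      have e : (6 * C₁ * C₂ + 3 * C₂) * (L1 * (L1 * Real.log Y + L1') * Real.log (Y / X)) -
          (6 * C₁ * C₂ * (L1 ^ 2 * Real.log Y) * Real.log (Y / X) +
            3 * C₂ * Real.log (Y / X) * (L1 * L1' + L1 ^ 2 * Real.log Y)) =
          6 * C₁ * C₂ * (L1 * L1' * Real.log (Y / X)) := by ring
      have hCC : 0 ≤ 6 * C₁ * C₂ * (L1 * L1' * Real.log (Y / X)) := by positivity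
      rw [hcalL]; linarith [hP, e, hCC]
    linarith [hΔre]
  have hlogY0 : 0 ≤ Real.log Y := by linarith
  have hcalL0 : 0 ≤ calL χ Y * Real.log (Y / X) := by
    rw [hcalL]
    exact mul_nonneg (mul_nonneg hL10 (add_nonneg (mul_nonneg hL10 hlogY0) hL1'0)) hlogYX0.le
  have hK0 : 0 ≤ 36 * C₁ * C₂ + 18 * C₂ := by positivity
  have hR0 : 0 ≤ Real.sqrt q * X ^ (-(9 / 20 : ℝ)) := by positivity
  calc 6 * Δ.re ≤ 6 * ((6 * C₁ * C₂ + 3 * C₂) * (calL χ Y * Real.log (Y / X)) +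
        2 * C₃ * Real.sqrt q * X ^ (-(9 / 20 : ℝ))) := by gcongr
    _ = (36 * C₁ * C₂ + 18 * C₂) * (calL χ Y * Real.log (Y / X)) +
          12 * C₃ * (Real.sqrt q * X ^ (-(9 / 20 : ℝ))) := by ring
    _ ≤ (36 * C₁ * C₂ + 18 * C₂ + 12 * C₃) * (calL χ Y * Real.log (Y / X)) +
          (36 * C₁ * C₂ + 18 * C₂ + 12 * C₃) * (Real.sqrt q * X ^ (-(9 / 20 : ℝ))) :=
        add_le_add (mul_le_mul_of_nonneg_right (by linarith) hcalL0)
          (mul_le_mul_of_nonneg_right (by linarith) hR0)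
    _ = (36 * C₁ * C₂ + 18 * C₂ + 12 * C₃) *
          (calL χ Y * Real.log (Y / X) + Real.sqrt q * X ^ (-(9 / 20 : ℝ))) := by ring

/-- **CONREY–IWANIEC (2002), COROLLARY 6.3 IN THE LARGE RANGE `X ≥ q²` (PROVED).**
"For `Y ≥ 2X ≥ 2` we have `Σ_{X ≤ n ≤ Y} τ²(n,χ) n^{-1} ≪ ℒ(Y) log(Y/X) + (q/X)^{1/2}` (6.49)" — here
for `X ≥ q²`, with the remainder `√q · X^{-9/20}` (`= q^{-2/5}` at `X = q²`; every use of (6.49) in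
§§6–9 has `X ≥ q²`), binders VERBATIM those of the typed `conreyIwaniec2002_corollary63`.
[cite: ConreyIwaniec2002, Corollary 6.3 (6.49)] -/
theorem corollary63_large :
    ∃ C : ℝ, 0 < C ∧
      ∀ (q : ℕ) [NeZero q], 4 < q → ∀ χ : DirichletCharacter ℂ q,
        χ.IsPrimitive → χ.IsQuadratic → χ.Odd →
          ∀ X Y : ℝ, (q : ℝ) ^ 2 ≤ X → 2 * X ≤ Y →
            ∑ n ∈ Finset.Icc ⌈X⌉₊ ⌊Y⌋₊, ‖divisorSumChar χ n‖ ^ 2 / (n : ℝ) ≤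
              C * (calL χ Y * Real.log (Y / X) + Real.sqrt q * X ^ (-(9 / 20 : ℝ))) :=
  corollary63_large_of norm_W_dCoeff_window_le gFun_zero_bounds explicit_formula_remainder_le

/-! ### Down the chain: Proposition 9.1, 9.2, Corollary 10.2, Theorem 1.1-weak from Proposition 8.1 alone -/

/-- **PROPOSITION 9.1 (`_large`: `T ≥ q^65`, `log T ≥ (log q)²`) FROM PROPOSITION 8.1 (`_large`) ALONE**
(Corollary 6.3 discharged in the large range; conclusion VERBATIM the `h1` of `principalEstimate_of`).
[cite: ConreyIwaniec2002, Proposition 9.1 (9.7)] -/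
theorem prop91_large_of_prop81_large
    (h81 : ∃ C : ℝ, 0 < C ∧
      ∀ (q : ℕ) [NeZero q], 4 < q → Odd q → ∀ χ : DirichletCharacter ℂ q,
        χ.IsPrimitive → χ.IsQuadratic → χ.Odd →
          ∀ (K : Type) [Field K] [NumberField K],
            Module.finrank ℚ K = 2 → NumberField.discr K = -(q : ℤ) →
              ∀ (ψ : ClassGroup (𝓞 K) →* ℂˣ) (T : ℝ) (S : Finset ℝ) (t' : ℝ → ℝ),
                (q : ℝ) ^ (65 : ℕ) ≤ T → Real.exp (Real.log q ^ (2 : ℕ)) ≤ T →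
                  IsDyadicPointSet S T →
                  defectD K ψ q S t' ≤
                    C * (T * Real.log q ^ (7 : ℕ) + T * calL χ T * Real.log T ^ (4 : ℕ))) :
    ∃ C : ℝ, 0 < C ∧
    ∀ (q : ℕ) [NeZero q], 4 < q → Odd q → ∀ χ : DirichletCharacter ℂ q,
      χ.IsPrimitive → χ.IsQuadratic → χ.Odd →
        ∀ (K : Type) [Field K] [NumberField K],
          Module.finrank ℚ K = 2 → NumberField.discr K = -(q : ℤ) →
            ∀ (ψ : ClassGroup (𝓞 K) →* ℂˣ) (T : ℝ) (S : Finset ℝ) (t' : ℝ → ℝ),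
              (q : ℝ) ^ (65 : ℕ) ≤ T → Real.exp (Real.log q ^ (2 : ℕ)) ≤ T → IsDyadicPointSet S T →
                defectE K ψ q S t' ≤
                  C * (T * Real.log q ^ (6 : ℕ) +
                    T * Real.sqrt (calL χ T) * Real.log T ^ (2 : ℕ) * Real.log q ^ ((5 : ℝ) / 2)) :=
  prop91_large_of_prop81_large_corollary63_large h81 corollary63_large

/-- **PROPOSITION 9.1 (`_large`) FROM THE TYPED PROPOSITION 8.1** (`conreyIwaniec2002_proposition81`,
via the tree's `prop81_large_of_proposition81`). [cite: ConreyIwaniec2002, Proposition 9.1 (9.7)] -/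
theorem prop91_large_of_proposition81 (h81 : conreyIwaniec2002_proposition81) :
    ∃ C : ℝ, 0 < C ∧
    ∀ (q : ℕ) [NeZero q], 4 < q → Odd q → ∀ χ : DirichletCharacter ℂ q,
      χ.IsPrimitive → χ.IsQuadratic → χ.Odd →
        ∀ (K : Type) [Field K] [NumberField K],
          Module.finrank ℚ K = 2 → NumberField.discr K = -(q : ℤ) →
            ∀ (ψ : ClassGroup (𝓞 K) →* ℂˣ) (T : ℝ) (S : Finset ℝ) (t' : ℝ → ℝ),
              (q : ℝ) ^ (65 : ℕ) ≤ T → Real.exp (Real.log q ^ (2 : ℕ)) ≤ T → IsDyadicPointSet S T →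
                defectE K ψ q S t' ≤
                  C * (T * Real.log q ^ (6 : ℕ) +
                    T * Real.sqrt (calL χ T) * Real.log T ^ (2 : ℕ) * Real.log q ^ ((5 : ℝ) / 2)) :=
  prop91_large_of_prop81_large (prop81_large_of_proposition81 h81)

/-- **COROLLARY 10.2 (Theorem 1.2 for odd `q`, exponent `−90`) FROM PROPOSITION 8.1 (`_large`) ALONE.**
[cite: ConreyIwaniec2002, Corollary 10.2] -/
theorem corollary102_of_prop81_large
    (h81 : ∃ C : ℝ, 0 < C ∧
      ∀ (q : ℕ) [NeZero q], 4 < q → Odd q → ∀ χ : DirichletCharacter ℂ q,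
        χ.IsPrimitive → χ.IsQuadratic → χ.Odd →
          ∀ (K : Type) [Field K] [NumberField K],
            Module.finrank ℚ K = 2 → NumberField.discr K = -(q : ℤ) →
              ∀ (ψ : ClassGroup (𝓞 K) →* ℂˣ) (T : ℝ) (S : Finset ℝ) (t' : ℝ → ℝ),
                (q : ℝ) ^ (65 : ℕ) ≤ T → Real.exp (Real.log q ^ (2 : ℕ)) ≤ T →
                  IsDyadicPointSet S T →
                  defectD K ψ q S t' ≤
                    C * (T * Real.log q ^ (7 : ℕ) + T * calL χ T * Real.log T ^ (4 : ℕ))) :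
    conreyIwaniec2002_corollary102 :=
  corollary102_of_proposition101_weak
    (proposition101_weak_of_principalEstimate_weak
      (principalEstimate_of ((7 : ℝ) / 2) (prop91_large_of_prop81_large h81) calL_le_of_small_weak))

/-- **THEOREM 1.1-WEAK (odd `q`, exponent `−(2A+7)`) FROM PROPOSITION 8.1 (`_large`) ALONE.**
[cite: ConreyIwaniec2002, Theorem 1.1] -/
theorem theorem11_weak_of_prop81_large
    (h81 : ∃ C : ℝ, 0 < C ∧
      ∀ (q : ℕ) [NeZero q], 4 < q → Odd q → ∀ χ : DirichletCharacter ℂ q,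
        χ.IsPrimitive → χ.IsQuadratic → χ.Odd →
          ∀ (K : Type) [Field K] [NumberField K],
            Module.finrank ℚ K = 2 → NumberField.discr K = -(q : ℤ) →
              ∀ (ψ : ClassGroup (𝓞 K) →* ℂˣ) (T : ℝ) (S : Finset ℝ) (t' : ℝ → ℝ),
                (q : ℝ) ^ (65 : ℕ) ≤ T → Real.exp (Real.log q ^ (2 : ℕ)) ≤ T →
                  IsDyadicPointSet S T →
                  defectD K ψ q S t' ≤
                    C * (T * Real.log q ^ (7 : ℕ) + T * calL χ T * Real.log T ^ (4 : ℕ))) :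
    conreyIwaniec2002_theorem11_weak :=
  theorem11_weak_of_proposition101_weak
    (proposition101_weak_of_principalEstimate_weak
      (principalEstimate_of ((7 : ℝ) / 2) (prop91_large_of_prop81_large h81) calL_le_of_small_weak))

end ConreyIwaniec2002

open ConreyIwaniec2002 NumberField

/-! ### Tree edges of record from the typed Proposition 8.1 -/

/-- **TYPED PROPOSITION 8.1 ⟹ PROPOSITION 9.2 AS TYPED (BY NAME), given the printed (9.11) claim**
(the tree's `conreyIwaniec2002_proposition92_of_proposition81_corollary63` with Corollary 6.3
discharged; `hLq` is the cosmetic claim of (9.11), open in the polylog regime — HONEST LABEL as there).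
[cite: ConreyIwaniec2002, Proposition 9.2 (9.12)] -/
theorem conreyIwaniec2002_proposition92_of_proposition81
    (h81 : conreyIwaniec2002_proposition81)
    (hLq : ∃ C : ℝ, 0 < C ∧
      ∀ (q : ℕ) [NeZero q], 4 < q → ∀ χ : DirichletCharacter ℂ q,
        χ.IsPrimitive → χ.IsQuadratic → χ.Odd → ∀ T : ℝ, 2 ≤ T →
          Real.log T * Real.sqrt ‖χ.LFunction 1‖ * Real.log q ^ (3 : ℕ) ≤ 1 →
            calL χ T ≤ C * (‖χ.LFunction 1‖ * Real.log q)) :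
    conreyIwaniec2002_proposition92 := by
  have h4 : ∃ C : ℝ, 0 < C ∧
      ∀ (q : ℕ) [NeZero q], 4 < q → ∀ χ : DirichletCharacter ℂ q,
        χ.IsPrimitive → χ.IsQuadratic → χ.Odd → ∀ T : ℝ, 2 ≤ T →
          Real.log T * Real.sqrt ‖χ.LFunction 1‖ * Real.log q ^ (3 : ℝ) ≤ 1 →
            calL χ T ≤ C * (‖χ.LFunction 1‖ * Real.log q ^ (2 * (3 : ℝ) - 5)) := by
    obtain ⟨C, hC, h⟩ := hLq
    refine ⟨C, hC, fun q _ hq χ hprim hquad hodd T hT hsm => ?_⟩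
    have e3 : Real.log q ^ (3 : ℝ) = Real.log q ^ (3 : ℕ) := by
      rw [← Real.rpow_natCast]; norm_num
    have e1 : Real.log q ^ (2 * (3 : ℝ) - 5) = Real.log q := by norm_num
    rw [e1]
    rw [e3] at hsm
    exact h q hq χ hprim hquad hodd T hT hsm
  obtain ⟨C, hC, h⟩ := principalEstimate_of 3 (prop91_large_of_proposition81 h81) h4
  refine ⟨C, hC, fun q _ hq hodd χ hprim hquad hoddχ K _ _ hK hdisc ψ T S t' hT hS => ?_⟩
  have := h q hq hodd χ hprim hquad hoddχ K hK hdisc ψ T S t' hT hS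
  have e3 : Real.log q ^ (3 : ℝ) = Real.log q ^ (3 : ℕ) := by
    rw [← Real.rpow_natCast]; norm_num
  rw [e3] at this
  exact this

/-- **TYPED PROPOSITION 8.1 ⟹ PROPOSITION 9.2 WITH `(log q)^{7/2}` (FACT-FREE in (9.11)).**
[cite: ConreyIwaniec2002, Proposition 9.2 (9.12)] -/
theorem conreyIwaniec2002_proposition92_weak_of_proposition81 (h81 : conreyIwaniec2002_proposition81) :
    ∃ C : ℝ, 0 < C ∧
    ∀ (q : ℕ) [NeZero q], 4 < q → Odd q → ∀ χ : DirichletCharacter ℂ q,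
      χ.IsPrimitive → χ.IsQuadratic → χ.Odd →
        ∀ (K : Type) [Field K] [NumberField K],
          Module.finrank ℚ K = 2 → NumberField.discr K = -(q : ℤ) →
            ∀ (ψ : ClassGroup (𝓞 K) →* ℂˣ) (T : ℝ) (S : Finset ℝ) (t' : ℝ → ℝ),
              2 ≤ T → IsPointSet S T →
                ∑ t ∈ S, sincTerm t (t' t) ≤
                  C * (T / Real.log T * Real.log q ^ (6 : ℕ) +
                    T * Real.log T * Real.sqrt ‖χ.LFunction 1‖ * Real.log q ^ ((7 : ℝ) / 2) +
                    Real.log q ^ ((5 : ℝ) / 2) / Real.log T *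
                      Real.sqrt (T * ∑ t ∈ S, ‖dividedDifference (classGroupLFunction K ψ)
                        (1 / 2 + t * I) (1 / 2 + t' t * I)‖ ^ 2)) :=
  principalEstimate_of ((7 : ℝ) / 2) (prop91_large_of_proposition81 h81) calL_le_of_small_weak

/-- **TYPED PROPOSITION 8.1 ⟹ COROLLARY 10.2** (`conreyIwaniec2002_corollary102`: Theorem 1.2 for odd
`q`, exponent `−90` — the Landau–Siegel-facing statement of the paper), Corollary 6.3 DISCHARGED.
[cite: ConreyIwaniec2002, Corollary 10.2] -/
theorem conreyIwaniec2002_corollary102_of_proposition81 (h81 : conreyIwaniec2002_proposition81) :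
    conreyIwaniec2002_corollary102 :=
  corollary102_of_prop81_large (prop81_large_of_proposition81 h81)

/-- **TYPED PROPOSITION 8.1 ⟹ THEOREM 1.1-WEAK** (`conreyIwaniec2002_theorem11_weak`: odd `q`,
exponent `−(2A+7)`), Corollary 6.3 DISCHARGED. [cite: ConreyIwaniec2002, Theorem 1.1] -/
theorem conreyIwaniec2002_theorem11_weak_of_proposition81 (h81 : conreyIwaniec2002_proposition81) :
    conreyIwaniec2002_theorem11_weak :=
  theorem11_weak_of_prop81_large (prop81_large_of_proposition81 h81)

/-! ### Sanity link: the typed Corollary 6.3 implies its large-range sibling -/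

/-- **The large-range sibling is WEAKER than the typed Corollary 6.3**: `conreyIwaniec2002_corollary63`
(remainder `(q/X)^{1/2}`, all `X ≥ 1`) implies the statement of `ConreyIwaniec2002.corollary63_large`
(remainder `√q · X^{-9/20}`, `X ≥ q²`), with the same constant — `(q/X)^{1/2} = √q X^{-1/2} ≤ √q X^{-9/20}`
for `X ≥ 1`. (Consistency check of the supersession: nothing typed was strengthened.)
[cite: ConreyIwaniec2002, Corollary 6.3 (6.49)] -/
theorem ConreyIwaniec2002.corollary63_large_of_corollary63 (h63 : conreyIwaniec2002_corollary63) :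
    ∃ C : ℝ, 0 < C ∧
      ∀ (q : ℕ) [NeZero q], 4 < q → ∀ χ : DirichletCharacter ℂ q,
        χ.IsPrimitive → χ.IsQuadratic → χ.Odd →
          ∀ X Y : ℝ, (q : ℝ) ^ 2 ≤ X → 2 * X ≤ Y →
            ∑ n ∈ Finset.Icc ⌈X⌉₊ ⌊Y⌋₊, ‖divisorSumChar χ n‖ ^ 2 / (n : ℝ) ≤
              C * (calL χ Y * Real.log (Y / X) + Real.sqrt q * X ^ (-(9 / 20 : ℝ))) := by
  obtain ⟨C, hC, h⟩ := h63
  refine ⟨C, hC, fun q _ hq χ hprim hquad hodd X Y hX hXY => ?_⟩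
  have hq5 : (5 : ℝ) ≤ q := by exact_mod_cast hq
  have hX1 : (1 : ℝ) ≤ X := le_trans (by nlinarith) hX
  have hX0 : 0 < X := by linarith
  have hmain := h q hq χ hprim hquad hodd X Y hX1 hXY
  refine hmain.trans (mul_le_mul_of_nonneg_left (add_le_add le_rfl ?_) hC.le)
  -- `√(q/X) = √q · X^{-1/2} ≤ √q · X^{-9/20}`
  rw [Real.sqrt_div' _ hX0.le, Real.sqrt_eq_rpow X, div_eq_mul_inv, ← Real.rpow_neg hX0.le]
  exact mul_le_mul_of_nonneg_left
    (Real.rpow_le_rpow_of_exponent_le hX1 (by norm_num)) (Real.sqrt_nonneg _)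

end Literature.NumberTheory.LFunctions

end
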